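import Mathlib
import HarnessLib
import Summits.HubbardSuperconductivity.HubbardSuperconductivity.Theorems.FunctionFieldCertificateWindowInfraredBoundEngines
import Summits.HubbardSuperconductivity.HubbardSuperconductivity.Theorems.WeakCouplingBCSWcbcsSsbToTorusLROTwoParticleCost
import Summits.HubbardSuperconductivity.HubbardSuperconductivity.Theorems.BalabanIRBirEveryGroundStateAffine
import Literature.MathematicalPhysics.QuantumLattice.HubbardModelParticleHoleProofs

/-!
# Crux `WindowInfraredBound` (stmt-HubbardSuperconductivity-1089) — reductions III: Engine A′, the
# ONE-SIDED pair-removal Landau floor + pair convexity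

Companion of `…WindowInfraredBoundReductions.lean` (§0–§2b), `…Engines.lean` (§3–§4) and
`…EngineB.lean` / `…EngineBCharging.lean` (Engine B on two inputs, the two-particle cost discharged by
`WcbcsSsbToTorusLRO.tpc_torus_summit`). Engine A (`wib_of_pairYrastFloorOne`) asked for a Landau floor `c|q|`
at BOTH vectors `Δ_d(m)ψ ∈ (N_L-2)` and `Δ_d(m)ᴴψ ∈ (N_L+2)` with respect to `K = H - μ'N̂` for a
floating chemical potential `μ'`. Here the input is halved:

* (Y₋) the PAIR-REMOVAL LANDAU FLOOR `Re⟨Δ_d(m)ψ, H Δ_d(m)ψ⟩ ≥ (E(N_L-2) + c|q_m|)‖Δ_d(m)ψ‖²` — the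
  `d`-wave pair-removal mode at total momentum `q ≠ 0` costs at least `c|q|` above the `(N_L-2, 0)`
  ground energy (one-sided; no chemical potential; no condition on the pair-addition mode);
* (Cvx) PAIR CONVEXITY `pairGap H N_L ≥ 0`, i.e. `E(N_L+2) + E(N_L-2) ≥ 2E(N_L)` (discrete convexity of
  the `S^z = 0` sector ground energies in steps of two at the summit filling).

`wib_of_pairRemovalFloor_of_pairConvexity : (Y₋) → (Cvx) → WindowInfraredBound`. Mechanism
(`goldstoneShape_of_pairRemovalFloor`): at `μ₊ = (E(N+2) - E(N))/2` the pair-ADDITION mode sits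
automatically at or above `ψ`'s level of `K = H - μ₊N̂` (variational principle in `(N+2, 0)`,
`minEnergyOn_mul_re_le`), and (Cvx) puts the `(N-2)`-bottom at or above it as well, so the reversed
Feynman–Bijl inequality needs the floor at `Δψ` only (`wib_weight_le_of_floor_of_nonneg`); the landed
double-commutator ceiling `stub_doubleCommBound` is used at `μ₊`, whose size `|μ₊| ≤ 144(2+|U|)` is the
landed two-particle cost `WcbcsSsbToTorusLRO.tpc_torus_summit`. No definition, no named fact, no sorry.

Sources: R. P. Feynman, Phys. Rev. 94 (1954) 262; L. Pitaevskii, S. Stringari, J. Low Temp. Phys. 85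
(1991) 377; H. Tasaki, *Physics and Mathematics of Quantum Many-Body Systems* (2020) §2.1.
-/

namespace Summit.HubbardSuperconductivity.HubbardSuperconductivity.Theorems

-- summit = problem name (single-conjunct summit, D-0017): `HubbardSuperconductivity` occurs twice in the path
set_option linter.dupNamespace false

open Literature.MathematicalPhysics.QuantumLattice Literature.Probability.LatticeModels Matrix Finset
open scoped ComplexOrder ComplexConjugate
open Summit.HubbardSuperconductivity.HubbardSuperconductivity.Theses

/-! ## §5 Engine A′ — the ONE-SIDED pair-removal Landau floor + pair convexity ⇒ the crux -/

section AbstractOneSided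

variable {n : Type*} [Fintype n]

/-- **Reversed Feynman–Bijl, floor at `Aψ` only.** For a Hermitian `K`, `Kψ = Eψ`, any `A`: a floor
`g > 0` on the Rayleigh quotient of `K - E` at `Aψ`, mere NONNEGATIVITY of it at `Aᴴψ`, and a ceiling
`Re⟨ψ,(Aᴴ[K,A] - [K,A]Aᴴ)ψ⟩ ≤ D` give `‖Aψ‖² ≤ D/g` (own-bottom identity
`WcbcsSsbToTorusLRO.mc_dotProduct_doubleComm_of_eigen`). [folklore] -/
theorem wib_weight_le_of_floor_of_nonneg {K : Matrix n n ℂ} (hK : K.IsHermitian) {ψ : n → ℂ}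
    {E g D : ℝ} (hψ : K *ᵥ ψ = (E : ℂ) • ψ) (A : Matrix n n ℂ) (hg : 0 < g)
    (h₁ : (E + g) * (star (A *ᵥ ψ) ⬝ᵥ (A *ᵥ ψ)).re ≤ (star (A *ᵥ ψ) ⬝ᵥ (K *ᵥ (A *ᵥ ψ))).re)
    (h₂ : E * (star (Aᴴ *ᵥ ψ) ⬝ᵥ (Aᴴ *ᵥ ψ)).re ≤ (star (Aᴴ *ᵥ ψ) ⬝ᵥ (K *ᵥ (Aᴴ *ᵥ ψ))).re)
    (hD : (star ψ ⬝ᵥ ((Aᴴ * (K * A - A * K) - (K * A - A * K) * Aᴴ) *ᵥ ψ)).re ≤ D) :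
    (star (A *ᵥ ψ) ⬝ᵥ (A *ᵥ ψ)).re ≤ D / g := by
  rw [WcbcsSsbToTorusLRO.mc_dotProduct_doubleComm_of_eigen hK hψ A] at hD
  simp only [Complex.add_re, Complex.sub_re, Complex.re_ofReal_mul] at hD
  rw [le_div_iff₀ hg]
  nlinarith [h₁, h₂]

end AbstractOneSided

/-- `Re⟨v, (H - μN̂) v⟩ = Re⟨v, H v⟩ - μ M ‖v‖²` for an `M`-particle vector `v` on the torus. [folklore] -/
theorem wib_re_hubbardTorusWith_rayleigh {L : ℕ} [NeZero L] (U μ : ℝ) {M : ℕ}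
    {v : Fock (Orb (FermionTorus 2 L))} (hv : IsNParticle M v) :
    (star v ⬝ᵥ (hubbardTorusWith 2 L 1 U μ *ᵥ v)).re =
      (star v ⬝ᵥ (hubbardTorus 2 L 1 U *ᵥ v)).re - μ * M * (star v ⬝ᵥ v).re := by
  rw [hubbardTorusWith_eq, sub_mulVec, smul_mulVec, totalNumber_mulVec_of_isNParticle hv,
    dotProduct_sub, dotProduct_smul, dotProduct_smul, smul_eq_mul, smul_eq_mul,
    show (μ : ℂ) * ((M : ℂ) * (star v ⬝ᵥ v)) = ((μ * M : ℝ) : ℂ) * (star v ⬝ᵥ v) by push_cast; ring,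
    Complex.sub_re, Complex.re_ofReal_mul]

/-- **Engine A′, one state, one momentum.** Let `ψ` be a normalised `(N, S^z=0)`-sector ground state of
`H = hubbardTorus 2 L 1 U`, `N ≥ 2`, `m ≠ 0`, `Δ = pairFieldAt dWaveFormFactor L m`, and write
`E(M) = minEnergyOn H (szSector M 0)`, `μ₊ = (E(N+2) - E(N))/2`. IF
(Y₋) the PAIR-REMOVAL LANDAU FLOOR `Re⟨Δψ, H Δψ⟩ ≥ (E(N-2) + c|q_m|)‖Δψ‖²` (the mode `Δ_d(q)ψ` costs at
least `c|q|` above the `(N-2)`-sector ground energy: pair-yrast at total momentum `q`, one-sided, no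
chemical potential), (Cvx) PAIR CONVEXITY `pairGap H N ≥ 0` (`E(N+2) + E(N-2) ≥ 2E(N)`), and the
double-commutator ceiling at `μ₊` (landed `stub_doubleCommBound`), THEN `S_ψ(m)·|q_m| ≤ C(1+|μ₊|)/c`.
Proof: with `K = H - μ₊N̂` the mode `Δᴴψ ∈ (N+2)` sits automatically at or above `ψ`'s `K`-level
(variational principle in `(N+2, 0)`), and (Cvx) puts `E(N-2) - μ₊(N-2)` at or above it too, so the
one-sided reversed Feynman–Bijl applies. [folklore] -/
theorem goldstoneShape_of_pairRemovalFloor {U : ℝ} {L : ℕ} [NeZero L] {N : ℕ} (hN : 2 ≤ N)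
    {ψ : Fock (Orb (FermionTorus 2 L))}
    (hψ : IsGroundStateInSector (hubbardTorus 2 L 1 U) N 0 ψ) (hψ1 : star ψ ⬝ᵥ ψ = 1)
    {m : TorusSite 2 L} (hm : m ≠ 0) {c C : ℝ} (hc : 0 < c)
    (hB : ∀ μ : ℝ, |(star ψ ⬝ᵥ (((pairFieldAt dWaveFormFactor L m)ᴴ *
        (hubbardTorusWith 2 L 1 U μ * pairFieldAt dWaveFormFactor L m -
          pairFieldAt dWaveFormFactor L m * hubbardTorusWith 2 L 1 U μ) -
        (hubbardTorusWith 2 L 1 U μ * pairFieldAt dWaveFormFactor L m -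
          pairFieldAt dWaveFormFactor L m * hubbardTorusWith 2 L 1 U μ) *
        (pairFieldAt dWaveFormFactor L m)ᴴ) *ᵥ ψ)).re| ≤
        C * (1 + |μ|) * (L : ℝ) ^ 2 * (star ψ ⬝ᵥ ψ).re)
    (hCvx : 0 ≤ pairGap (hubbardTorus 2 L 1 U) N)
    (hY : ((hubbardTorus 2 L 1 U).minEnergyOn (szSector (N - 2) 0) +
        c * Real.sqrt (momentumNormSq L m)) *
          (star (pairFieldAt dWaveFormFactor L m *ᵥ ψ) ⬝ᵥ (pairFieldAt dWaveFormFactor L m *ᵥ ψ)).re ≤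
        (star (pairFieldAt dWaveFormFactor L m *ᵥ ψ) ⬝ᵥ
          (hubbardTorus 2 L 1 U *ᵥ (pairFieldAt dWaveFormFactor L m *ᵥ ψ))).re) :
    pairStructureFactor dWaveFormFactor L ψ m * Real.sqrt (momentumNormSq L m) ≤
      C * (1 + |((hubbardTorus 2 L 1 U).minEnergyOn (szSector (N + 2) 0) -
        (hubbardTorus 2 L 1 U).minEnergyOn (szSector N 0)) / 2|) / c := by
  set H := hubbardTorus 2 L 1 U with hH
  set Δ := pairFieldAt dWaveFormFactor L m with hΔ
  set E := H.minEnergyOn (szSector N 0) with hE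
  set Ep := H.minEnergyOn (szSector (N + 2) 0) with hEp
  set Em := H.minEnergyOn (szSector (N - 2) 0) with hEm
  set μ : ℝ := (Ep - E) / 2 with hμ
  set K := hubbardTorusWith 2 L 1 U μ with hKdef
  have hK : K.IsHermitian := isHermitian_hubbardTorusWith L 1 U μ
  have hKψ : K *ᵥ ψ = ((E - μ * N : ℝ) : ℂ) • ψ := by
    have h := sub_smul_totalNumber_mulVec_of_isGroundStateInSector hψ μ
    rw [← hubbardTorusWith_eq] at h
    exact h
  -- sector bookkeeping
  obtain ⟨hψK, -, -⟩ := hψ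
  have hvm : Δ *ᵥ ψ ∈ szSector (N - 2) 0 :=
    WcbcsSsbToTorusLRO.pairFieldAt_mulVec_mem_szSector dWaveFormFactor m hN hψK
  have hvp : Δᴴ *ᵥ ψ ∈ szSector (N + 2) 0 :=
    WcbcsSsbToTorusLRO.conjTranspose_pairFieldAt_mulVec_mem_szSector dWaveFormFactor m hψK
  have hNm : IsNParticle (N - 2) (Δ *ᵥ ψ) := ((mem_szSector_iff _ _ _).1 hvm).1
  have hNp : IsNParticle (N + 2) (Δᴴ *ᵥ ψ) := ((mem_szSector_iff _ _ _).1 hvp).1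
  set Sm := (star (Δ *ᵥ ψ) ⬝ᵥ (Δ *ᵥ ψ)).re with hSm
  set Sp := (star (Δᴴ *ᵥ ψ) ⬝ᵥ (Δᴴ *ᵥ ψ)).re with hSp
  have hSm0 : 0 ≤ Sm := (Complex.nonneg_iff.1 (dotProduct_star_self_nonneg _)).1
  have hSp0 : 0 ≤ Sp := (Complex.nonneg_iff.1 (dotProduct_star_self_nonneg _)).1
  have hQ : 0 < momentumNormSq L m :=
    (momentumNormSq_nonneg m).lt_of_ne' (fun h0 => hm ((momentumNormSq_eq_zero_iff m).1 h0))
  have hq : 0 < Real.sqrt (momentumNormSq L m) := Real.sqrt_pos.2 hQ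
  have hg : 0 < c * Real.sqrt (momentumNormSq L m) := mul_pos hc hq
  -- Rayleigh quotients of `K`
  have hRm : (star (Δ *ᵥ ψ) ⬝ᵥ (K *ᵥ (Δ *ᵥ ψ))).re =
      (star (Δ *ᵥ ψ) ⬝ᵥ (H *ᵥ (Δ *ᵥ ψ))).re - μ * ((N - 2 : ℕ) : ℝ) * Sm :=
    wib_re_hubbardTorusWith_rayleigh U μ hNm
  have hRp : (star (Δᴴ *ᵥ ψ) ⬝ᵥ (K *ᵥ (Δᴴ *ᵥ ψ))).re =
      (star (Δᴴ *ᵥ ψ) ⬝ᵥ (H *ᵥ (Δᴴ *ᵥ ψ))).re - μ * ((N + 2 : ℕ) : ℝ) * Sp :=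
    wib_re_hubbardTorusWith_rayleigh U μ hNp
  have hN2 : ((N - 2 : ℕ) : ℝ) = (N : ℝ) - 2 := by
    rw [Nat.cast_sub hN]; norm_num
  have hN2' : ((N + 2 : ℕ) : ℝ) = (N : ℝ) + 2 := by push_cast; ring
  -- (h₁): the floor at `Δψ`, shifted by pair convexity
  have hgap : 0 ≤ Ep + Em - 2 * E := by
    have h := hCvx
    unfold pairGap at h
    rw [← hEp, ← hEm, ← hE] at h
    linarith
  have h₁ : (E - μ * N + c * Real.sqrt (momentumNormSq L m)) * Sm ≤
      (star (Δ *ᵥ ψ) ⬝ᵥ (K *ᵥ (Δ *ᵥ ψ))).re := by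
    rw [hRm, hN2]
    have hshift : (E - μ * N) * Sm ≤ (Em - μ * ((N : ℝ) - 2)) * Sm := by
      refine mul_le_mul_of_nonneg_right ?_ hSm0
      rw [hμ]; linarith
    nlinarith [hY, hshift]
  -- (h₂): nonnegativity at `Δᴴψ` (variational principle in `(N+2, 0)`)
  have h₂ : (E - μ * N) * Sp ≤ (star (Δᴴ *ᵥ ψ) ⬝ᵥ (K *ᵥ (Δᴴ *ᵥ ψ))).re := by
    rw [hRp, hN2']
    have hvar : Ep * Sp ≤ (star (Δᴴ *ᵥ ψ) ⬝ᵥ (H *ᵥ (Δᴴ *ᵥ ψ))).re :=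
      minEnergyOn_mul_re_le H (szSector (N + 2) 0) hvp
    have hEq : E - μ * N = Ep - μ * ((N : ℝ) + 2) := by rw [hμ]; ring
    rw [hEq]
    nlinarith [hvar]
  -- the ceiling at `μ₊`
  have hD : (star ψ ⬝ᵥ ((Δᴴ * (K * Δ - Δ * K) - (K * Δ - Δ * K) * Δᴴ) *ᵥ ψ)).re ≤
      C * (1 + |μ|) * (L : ℝ) ^ 2 := by
    have h := (le_abs_self _).trans (hB μ)
    rwa [hψ1, Complex.one_re, mul_one] at h
  have hw := wib_weight_le_of_floor_of_nonneg hK hKψ Δ hg h₁ h₂ hD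
  -- conclude as in Engine A
  have hL : (0 : ℝ) < (L : ℝ) ^ 2 := by
    have : (0 : ℝ) < L := Nat.cast_pos.2 (Nat.pos_of_ne_zero (NeZero.ne L))
    positivity
  rw [le_div_iff₀ hg] at hw
  rw [pairStructureFactor_apply, ← hΔ, ← hSm, div_mul_eq_mul_div, div_le_iff₀ hL, div_mul_eq_mul_div,
    le_div_iff₀ hc]
  calc Sm * Real.sqrt (momentumNormSq L m) * c = Sm * (c * Real.sqrt (momentumNormSq L m)) := by ring
    _ ≤ C * (1 + |μ|) * (L : ℝ) ^ 2 := hw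

/-- **Engine A′ ⇒ the crux.** HYPOTHESES, pointwise in `(U, δ)`, eventually along even sides, for every
normalised `(N_L, 0)`-sector ground state `ψ` of `H = hubbardTorus 2 L 1 U` (`E(M) = minEnergyOn H (szSector M 0)`):
(Y₋) the PAIR-REMOVAL LANDAU FLOOR at every window momentum `0 < |q_m| ≤ η`:
`Re⟨Δ_d(m)ψ, H Δ_d(m)ψ⟩ ≥ (E(N_L-2) + c|q_m|) ‖Δ_d(m)ψ‖²` — ONE-SIDED (no condition on `Δ_d(m)ᴴψ`, no
floating chemical potential): the physics input, Landau's criterion for removing a `d`-wave pair at total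
momentum `q ≠ 0` (phase mode `v_s|q|` / two nodal quasiparticles); and (Cvx) PAIR CONVEXITY
`pairGap H N_L ≥ 0`. CONCLUSION: `WindowInfraredBound`, with `C = 32·C_B(1 + 144(2+|U|))/c` (`C_B` from
the landed double-commutator bound, `|μ₊| ≤ 144(2+|U|)` from the landed two-particle cost
`WcbcsSsbToTorusLRO.tpc_torus_summit`). [folklore] -/
theorem wib_of_pairRemovalFloor_of_pairConvexity
    (hY : ∀ U : ℝ, 0 < U → ∀ δ ∈ Set.Ioo (0:ℝ) (1 / 2), ∃ c η : ℝ, 0 < c ∧ 0 < η ∧ ∃ L₀ : ℕ,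
      ∀ (L : ℕ) [NeZero L], L₀ ≤ L → Even L → ∀ ψ : Fock (Orb (FermionTorus 2 L)),
        star ψ ⬝ᵥ ψ = 1 →
          IsGroundStateInSector (hubbardTorus 2 L 1 U) (2 * ⌊(1 - δ) * (L : ℝ) ^ 2 / 2⌋₊) 0 ψ →
            ∀ m : TorusSite 2 L, m ≠ 0 → momentumNormSq L m ≤ η ^ 2 →
              ((hubbardTorus 2 L 1 U).minEnergyOn (szSector (2 * ⌊(1 - δ) * (L : ℝ) ^ 2 / 2⌋₊ - 2) 0) +
                  c * Real.sqrt (momentumNormSq L m)) *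
                  (star (pairFieldAt dWaveFormFactor L m *ᵥ ψ) ⬝ᵥ
                    (pairFieldAt dWaveFormFactor L m *ᵥ ψ)).re ≤
                (star (pairFieldAt dWaveFormFactor L m *ᵥ ψ) ⬝ᵥ
                  (hubbardTorus 2 L 1 U *ᵥ (pairFieldAt dWaveFormFactor L m *ᵥ ψ))).re)
    (hCvx : ∀ U : ℝ, 0 < U → ∀ δ ∈ Set.Ioo (0:ℝ) (1 / 2), ∃ L₀ : ℕ,
      ∀ (L : ℕ) [NeZero L], L₀ ≤ L → Even L →
        0 ≤ pairGap (hubbardTorus 2 L 1 U) (2 * ⌊(1 - δ) * (L : ℝ) ^ 2 / 2⌋₊)) :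
    FunctionFieldCertificate.WindowInfraredBound := by
  refine wib_of_goldstoneShape fun U hU δ hδ => ?_
  obtain ⟨c, η, hc, hη, L₁, hY'⟩ := hY U hU δ hδ
  obtain ⟨L₂, hCvx'⟩ := hCvx U hU δ hδ
  obtain ⟨C, hC, hB⟩ := stub_doubleCommBound U hU
  set T : ℝ := 16 * (((2 * 4 + 1 : ℕ) : ℝ) * (2 * (2 * |(1 : ℝ)| + |U|))) with hT
  have hT0 : 0 ≤ T := by positivity
  refine ⟨C * (1 + T / 2) / c, η, by positivity, hη, max (max L₁ L₂) 4,
    fun L _ hL₀ hev ψ hψ1 hψ m hm0 hmη => ?_⟩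
  have hL₁ : L₁ ≤ L := le_trans (le_max_left _ _) ((le_max_left _ _).trans hL₀)
  have hL₂ : L₂ ≤ L := le_trans (le_max_right _ _) ((le_max_left _ _).trans hL₀)
  have hL4 : 4 ≤ L := (le_max_right _ _).trans hL₀
  have hN : 2 ≤ 2 * ⌊(1 - δ) * (L : ℝ) ^ 2 / 2⌋₊ := wib_two_le_summitFilling hδ (by omega)
  have hshape := goldstoneShape_of_pairRemovalFloor hN hψ hψ1 hm0 hc (fun μ => hB L μ m ψ)
    (hCvx' L hL₂ hev) (hY' L hL₁ hev ψ hψ1 hψ m hm0 hmη)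
  -- `|μ₊| ≤ T/2` from the landed two-particle cost
  have hcost := (WcbcsSsbToTorusLRO.tpc_torus_summit U δ hδ L hL4).2
  have hμ : |((hubbardTorus 2 L 1 U).minEnergyOn (szSector (2 * ⌊(1 - δ) * (L : ℝ) ^ 2 / 2⌋₊ + 2) 0) -
      (hubbardTorus 2 L 1 U).minEnergyOn (szSector (2 * ⌊(1 - δ) * (L : ℝ) ^ 2 / 2⌋₊) 0)) / 2| ≤
      T / 2 := by
    rw [abs_div, abs_two]
    exact div_le_div_of_nonneg_right hcost zero_le_two
  refine hshape.trans (div_le_div_of_nonneg_right ?_ hc.le)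
  exact mul_le_mul_of_nonneg_left (by linarith [hμ]) hC

end Summit.HubbardSuperconductivity.HubbardSuperconductivity.Theorems
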